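import Mathlib
import Summits.CriticalPhenomena.Ising3DConformalLimit.Theses.GaussianScaleMixture
import Summits.CriticalPhenomena.Ising3DConformalLimit.Theorems.GaussianScaleMixtureCriticalTwoPointGSMCriticalTwoPointGSMOfCubeRepNoFace
import Summits.CriticalPhenomena.Ising3DConformalLimit.Theorems.GaussianScaleMixtureCriticalTwoPointGSMCubeRepOfCubeRepApprox
import Summits.CriticalPhenomena.Ising3DConformalLimit.Theorems.GaussianScaleMixtureCriticalTwoPointGSMClosedConeReduction
import Literature.Probability.LatticeModels.TorusTwoPointLimit
import Literature.Probability.LatticeModels.CriticalTwoPointBounds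
import Literature.Probability.LatticeModels.HighDimPointwiseTriviality

/-!
# Line `torus-theta` — the FINITE-VOLUME (periodic theta-mixture) spine for the crux
`CriticalTwoPointGSM` (stmt-CriticalPhenomena-8365), crux-strategist seat, 2026-08-16

Route `GaussianScaleMixture` of `Ising3DConformalLimit`; crux r2:
`⟨σ₀σ_x⟩⁺_{β_c}` on `ℤ³` is a Gaussian scale mixture (GSM) in the squared coordinates.

## Idea (the one lever the four lead seats of line `Sketch` left UNTRIED: "finite-volume spine")

Periodising a GSM kernel `∫ e^{-∑ sᵢxᵢ²} dν` over `(Nℤ)³` gives a mixture of PRODUCTS OF PERIODIC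
GAUSSIANS ("theta kernels") `∏ᵢ θ_N(xᵢ; sᵢ)`, `θ_N(n; s) = ∑_{m∈ℤ} e^{-s(n+mN)²}`. The finite-volume
form of the crux is therefore: the two-point function of the n.n. Ising model on the discrete torus
`(ℤ/N)³` at `β_c` is a THETA SCALE MIXTURE — in cube coordinates `tᵢ = e^{-sᵢ} ∈ [0,1]`,
`⟨σ_0̄ σ_x̄⟩_{𝕋_N, β_c} = ∫ ∏ᵢ thetaKer N (xᵢ) (tᵢ) dμ_N(t)` with `μ_N` a probability measure on the
closed cube and `thetaKer N n t = (∑_m t^{(n+mN)²}) / (∑_m t^{(mN)²})` the normalised theta kernel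
(INLINED in every statement below, so that each stub elaborates over tree declarations alone)
(`t = 1`: constant clock; `t = 0`: the indicator of `N ∣ n`, the torus "face"). Each instance is a
statement about a FINITE Gibbs measure (2^{N³} configurations; the natural habitat of graph-by-graph
correlation inequalities — GKS, FKG, random currents / switching, reflection positivity on even
tori — and of EXACT verification by transfer matrices for small `N`), rational in `e^{2β}` for fixed
`N`. As `N → ∞`: the torus two-point function converges to `⟨σ₀σ_x⟩⁺_{β_c}`
(`abs_isingTorusTwoPoint_sub_plusCorr_le_of_spontaneousMagnetization_eq_zero` + `m*(β_c) = 0` in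
`d = 3`, tree), and the normalised theta kernels converge to the cube kernels `t^{n²}` UNIFORMLY on
`[0,1]` (stub `thetaKer_tendsto_uniformly`, rate `O(n²/N²)`), so the torus mixing measures are
cube-approximants of `criticalTwoPoint 3` and `Theorems.cubeRep_of_cubeRepApprox` (p104062) gives
CLOSED-CONE membership; the residue `faceAbsorption` (shared verbatim with line `Sketch`) then gives
the crux (`Theorems.criticalTwoPointGSM_of_cubeRepNoFace`, p98640).

Exact small-torus evidence behind the physical stub (this seat; see `Lines/torus_theta.md` §N1):
kit j020792 (DONE) — transfer-matrix two-point functions on `3³` (β = 0.2, β_c), `4³` (β_c), `4²×8`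
(β_c) in 3D and `4²`, `8²` in 2D are all INSIDE the theta-mixture cone (LP misfit 0, no dual
certificate; GFF control feasible, diagonal-favouring control certified infeasible; all mirror
stencils positive); kit j020841 (β-scan over `3³, 3²×6, 4³, 4²×{6,8,16}` and 2D `N²`, `N ≤ 16`,
`β ∈ [0.05, 1.2] ∪ {β_c}`, j022204 small-first scan): every computed case inside the cone, data
INTERIOR (grid-converged radii), single-orbit perturbations certified infeasible; kit j020853
(whole-torus MC on `6³…12³` at β_c): inside within 0.04σ; kit j022848: RIGOROUS instance — on
`(ℤ/3)³` theta-GSM ⇔ four integer-polynomial inequalities in `e^β` (tetrahedron reduction), decided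
by exact 2^27 enumeration + exact real-root counting: the `(ℤ/3)³` torus two-point function is a
theta scale mixture for ALL `β ≥ 0` (computer-assisted theorem). Tables: `Lines/torus_theta.md`.

## Stubs → crux

`CriticalTwoPointGSM_of := criticalTwoPointGSM_of_cubeRepNoFace (faceAbsorption (closedConeGSM_of_torusThetaGSM thetaKer_tendsto_uniformly torusThetaGSM))`.
-/

namespace Summit.CriticalPhenomena.Ising3DConformalLimit.Cruxes.CriticalTwoPointGSM.Lines.TorusTheta

open MeasureTheory Filter Topology
open Literature.Probability.LatticeModels
open Summit.CriticalPhenomena.Ising3DConformalLimit.Theses.GaussianScaleMixture (CriticalTwoPointGSM)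
open scoped BigOperators

noncomputable section

/-! ### The theta kernel (inlined in every statement so that the stubs are self-contained over tree declarations)

`thetaKer N n t := if t < 1 then (∑' m : ℤ, t ^ ((n + m N).natAbs ^ 2)) / (∑' m : ℤ, t ^ ((m N).natAbs ^ 2)) else 1`
— the normalised periodic Gaussian of `ℤ/N` in the cube coordinate `t = e^{-s} ∈ [0,1]` (`ℕ`-powers, `0⁰ = 1`,
so the value at `t = 0` is the torus face kernel `𝟙[N ∣ n]`; the value `1` for `t ≥ 1` is the constant clock
`s = 0`, where both series diverge; for `0 < t < 1` it is `θ_N(n;s)/θ_N(0;s)`, the periodisation of `e^{-sn²}`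
normalised to `1` at `n = 0`). -/

/-! ## Stubs -/

/-- **STUB `torusThetaGSM` (physical input; OPEN; the finite-volume form of the crux).** For every
`N ≥ 4` the two-point function of the nearest-neighbour Ising model on the discrete torus `(ℤ/N)³`
at `β = β_c(3)` is a theta scale mixture: a probability measure `μ` on `ℝ³` carried by the closed
cube `[0,1]³` with `⟨σ_{0̄} σ_{x̄}⟩_{𝕋_N;β_c,0} = ∫ ∏ᵢ thetaKer N (xᵢ) (tᵢ) dμ(t)` for every
`x ∈ ℤ³` (`x̄ = Torus.proj N x`). Exactly verified (LP-feasible to grid precision, no dual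
certificate) on the tori listed in `Lines/torus_theta.md`; what a graph-by-graph positivity
mechanism (switching lemma / species-field mirror coupling on the finite torus) would prove. -/
theorem torusThetaGSM :
    ∀ N : ℕ, 4 ≤ N → ∀ [NeZero N],
      ∃ μ : Measure (Fin 3 → ℝ), IsProbabilityMeasure μ ∧ μ {t | ∃ i, t i < 0 ∨ 1 < t i} = 0 ∧
        ∀ x : Site 3, isingTorusTwoPoint 3 N (criticalBeta 3) 0 (Torus.proj N 0) (Torus.proj N x) =
          ∫ t, ∏ i, (if t i < 1 then (∑' m : ℤ, (t i) ^ ((x i + m * (N : ℤ)).natAbs ^ 2)) / (∑' m : ℤ, (t i) ^ ((m * (N : ℤ)).natAbs ^ 2)) else 1) ∂μ := by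
  sorry

/-- **STUB `thetaKer_tendsto_uniformly` (analysis; provable, size M/L).** The normalised theta
kernels converge to the cube kernels uniformly on the closed cube coordinate interval:
`sup_{t ∈ [0,1]} |thetaKer N n t − t^{n²}| → 0` as `N → ∞`, for every fixed `n ∈ ℤ`
(paper proof: for `s ≥ 1/N²` pair the images `±m`,
`θ_N(n;s) − t^{n²}θ_N(0;s) = ∑_{m≥1} 2e^{-s(m²N²+n²)}(cosh(2smN|n|) − 1) ∈ [0, C n²/N²]`;
for `s ≤ 1/N²` both `thetaKer` and `t^{n²}` are within `C(|n|/N + n²/N²)` of `1` by comparing the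
Gaussian sums over `m` with their integrals). -/
theorem thetaKer_tendsto_uniformly :
    ∀ n : ℤ, TendstoUniformlyOn (fun N : ℕ => fun t : ℝ => (if t < 1 then (∑' m : ℤ, t ^ ((n + m * (N : ℤ)).natAbs ^ 2)) / (∑' m : ℤ, t ^ ((m * (N : ℤ)).natAbs ^ 2)) else 1))
      (fun t : ℝ => t ^ (n.natAbs ^ 2)) atTop (Set.Icc (0 : ℝ) 1) := by
  sorry

/-- **STUB `closedConeGSM_of_torusThetaGSM` (limit transfer; provable, size M).** Theta-GSM of the
torus two-point functions along `N → ∞` plus uniform convergence of the theta kernels give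
CLOSED-CONE membership of `criticalTwoPoint 3`: for each finite family of sites and `ε > 0`, a torus
mixing measure `μ_N` with `N` large is a cube-approximant (torus → infinite volume at `β_c` by
`abs_isingTorusTwoPoint_sub_plusCorr_le_of_spontaneousMagnetization_eq_zero`,
`spontaneousMagnetization_criticalBeta_eq_zero_holds` (`d = 3`), `twoPointPlus_eq_plusCorr`,
`criticalTwoPoint_zero'`; kernel swap by the uniform convergence), and
`Theorems.cubeRep_of_cubeRepApprox` (p104062) concludes. -/
theorem closedConeGSM_of_torusThetaGSM
    (hunif : ∀ n : ℤ, TendstoUniformlyOn (fun N : ℕ => fun t : ℝ => (if t < 1 then (∑' m : ℤ, t ^ ((n + m * (N : ℤ)).natAbs ^ 2)) / (∑' m : ℤ, t ^ ((m * (N : ℤ)).natAbs ^ 2)) else 1))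
      (fun t : ℝ => t ^ (n.natAbs ^ 2)) atTop (Set.Icc (0 : ℝ) 1))
    (htorus : ∀ N : ℕ, 4 ≤ N → ∀ [NeZero N],
      ∃ μ : Measure (Fin 3 → ℝ), IsProbabilityMeasure μ ∧ μ {t | ∃ i, t i < 0 ∨ 1 < t i} = 0 ∧
        ∀ x : Site 3, isingTorusTwoPoint 3 N (criticalBeta 3) 0 (Torus.proj N 0) (Torus.proj N x) =
          ∫ t, ∏ i, (if t i < 1 then (∑' m : ℤ, (t i) ^ ((x i + m * (N : ℤ)).natAbs ^ 2)) / (∑' m : ℤ, (t i) ^ ((m * (N : ℤ)).natAbs ^ 2)) else 1) ∂μ) :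
    ∃ μ : Measure (Fin 3 → ℝ), IsProbabilityMeasure μ ∧ μ {t | ∃ i, t i < 0 ∨ 1 < t i} = 0 ∧
      ∀ x : Site 3, criticalTwoPoint 3 x = ∫ t, ∏ i, (t i) ^ ((x i).natAbs ^ 2) ∂μ := by
  sorry

/-- **STUB `faceAbsorption` (the residue; shared verbatim with line `Sketch`; NECESSARY for the crux
as typed, `Theorems.cubeRepNoFace_of_criticalTwoPointGSM`).** If `criticalTwoPoint 3` has a cube
representation (closed-cone membership), then it has one WITHOUT face mass (carried by `(0,1]³`).
Void once the crux is re-typed as closed-cone membership (strategist's split `ClosedConeGSM`). -/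
theorem faceAbsorption
    (h : ∃ μ : Measure (Fin 3 → ℝ), IsProbabilityMeasure μ ∧ μ {t | ∃ i, t i < 0 ∨ 1 < t i} = 0 ∧
      ∀ x : Site 3, criticalTwoPoint 3 x = ∫ t, ∏ i, (t i) ^ ((x i).natAbs ^ 2) ∂μ) :
    ∃ μ : Measure (Fin 3 → ℝ), IsProbabilityMeasure μ ∧ μ {t | ∃ i, t i ≤ 0 ∨ 1 < t i} = 0 ∧
      ∀ x : Site 3, criticalTwoPoint 3 x = ∫ t, ∏ i, (t i) ^ ((x i).natAbs ^ 2) ∂μ := by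
  sorry

/-! ## Glue proved in the skeleton -/

/-- The physical stub implies closed-cone membership of the infinite-volume critical two-point
function (the two provable stubs assembled). -/
theorem closedConeGSM :
    ∃ μ : Measure (Fin 3 → ℝ), IsProbabilityMeasure μ ∧ μ {t | ∃ i, t i < 0 ∨ 1 < t i} = 0 ∧
      ∀ x : Site 3, criticalTwoPoint 3 x = ∫ t, ∏ i, (t i) ^ ((x i).natAbs ^ 2) ∂μ :=
  closedConeGSM_of_torusThetaGSM thetaKer_tendsto_uniformly
    (fun N hN _ => torusThetaGSM N hN)

/-- The finite-volume spine passes every square-lacunary dual-cone certificate of the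
infinite-volume critical two-point function (importable kill switch, via
`Theorems.closedConeGSM_iff_dualCone`, p123948). -/
theorem dualCone_of_torusThetaGSM {m : ℕ} (c : Fin m → ℝ) (x : Fin m → Site 3)
    (hc : ∀ t : Fin 3 → ℝ, (∀ i, 0 ≤ t i ∧ t i ≤ 1) → 0 ≤ ∑ k, c k * ∏ i, (t i) ^ ((x k i).natAbs ^ 2)) :
    0 ≤ ∑ k, c k * criticalTwoPoint 3 (x k) :=
  (Theorems.closedConeGSM_iff_dualCone.1 closedConeGSM) m c x hc

/-! ## The composition -/

/-- **Skeleton theorem.** The crux `CriticalTwoPointGSM` from the stubs: theta-GSM of the torus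
two-point functions (`torusThetaGSM`, physical) + uniform convergence of the theta kernels
(`thetaKer_tendsto_uniformly`) give closed-cone membership (`closedConeGSM_of_torusThetaGSM`),
`faceAbsorption` removes the face mass, and `Theorems.criticalTwoPointGSM_of_cubeRepNoFace`
(p98640) concludes. -/
theorem CriticalTwoPointGSM_of : CriticalTwoPointGSM :=
  Theorems.criticalTwoPointGSM_of_cubeRepNoFace (faceAbsorption closedConeGSM)

end

end Summit.CriticalPhenomena.Ising3DConformalLimit.Cruxes.CriticalTwoPointGSM.Lines.TorusTheta
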